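import Summits.CriticalPhenomena.CardyFormulaZ2.Theorems.CardyComplexConeEdgePrecompactMedialExplorationShiftData
import Literature.Probability.LatticeModels.DartPhase
import Literature.Probability.LatticeModels.MedialWindingBridge

/-!
# Shift stability of the corner observable: reduction to its two inputs
(line `qkz-strip-boundary-arm` of crux `CardyComplexCone.EdgePrecompact`, stmt-CriticalPhenomena-11387)

The picked skeleton `Cruxes/EdgePrecompact/Lines/qkz-strip-boundary-arm.lean` obtains clause (ii) of the
crux from `stub_translationCovariance` and `stub_shiftStability : UniformInnerEnvelope → ShiftStability`
(vocabulary in `Theorems/CardyComplexConeDefs.lean`). This file is the stub worker's report on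
`stub_shiftStability`, in checked form.

1. SHAPE. `ShiftStability` compares, in ONE configuration, the corner observable of the datum `Λ δ`
   with that of its own lattice translate `shiftData (Λ δ) (-w)` (`‖δw‖ < η`), at precision
   `ε δ^{1/3}` for EVERY `ε > 0`. The hypothesis `UniformInnerEnvelope` bounds each term separately by
   `C (ρ_K/2δ)^{-1/3} = C (2/ρ_K)^{1/3} δ^{1/3}` (`ρ_K = dist (K, ∂D)`; the translate of a Dobrushin
   domain is one, and the depth of `δv` in `D - δw` is `≥ ρ_K - η`), i.e. the difference by a FIXED multiple of `δ^{1/3}`, never by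
   `ε δ^{1/3}`: the implication is not available cheaply, and its hypothesis is not used below. No
   degeneration makes it false either: `w ∈ ℤ²`, so the translate of the data is discretised by the
   translated sites (`mem_meshDomain_vadd`), admissibility is transported (`isZdAdmissible_shiftData`,
   proved here), and for `η < ρ_K` the two corners `δv`, `δ(v+w) ∈ K` see the same lattice geometry;
   arc pathologies of `Λ δ` are shared by the translate. What is missing is exactly one decoupling.
2. THE TWO INPUTS (hypotheses of `shiftStability_of`, spelled out inline; `F_{v,f}(ω) :=
   dartPhaseSum (medialExploration E ω) δ (1/3) (v,f)` is the integrand of `cornerObs`,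
   `cornerObs_eq_integral_dartPhaseSum`; "measurable off the ball `B(z,ρ)`" is measurability for
   `MeasurableSpace.comap (fun ω => ω \ {e | medialPoint δ e ∈ ball z ρ}) _`):
   (X1) UNIFORM INTEGRABILITY OF THE LOCALISED TWISTED AMPLITUDE — `∀ ε₁ > 0 ∃ ε' > 0`: for every
   admissible `E`, corner `(v,f)`, radius `ρ ≥ E.δ` with `closedBall (δv) ρ ⊆ E.Ω` and every event `A`
   measurable off `B(δv,ρ)` with `P(A) ≤ ε'`, `‖E[F_{v,f} ; A]‖ ≤ ε₁ (E.δ/ρ)^{1/3}`. This is the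
   conditional twin of the line's (T) and the open core of the stub (the sibling skeleton
   `Lines/shift-coupling-phase-exact.lean` types the stronger affine form `≤ (C·P(A)+ε₁)(δ/ρ)^{1/3}` as
   `Sig.stub_localInnerEnvelope`; only its small-`P(A)` tail is consumed, so only that is asked).
   (X2) SHIFT-COUPLING LOCALITY — along a family `Λ` of `D`, on `K` with `cthickening (2ρ) K ⊆ D`:
   `∀ ε > 0 ∃ η > 0`, eventually in `δ`, for `δv ∈ K`, `‖δw‖ < η` there is an event `B` measurable off
   `B(δv,ρ)` with `P(B) ≤ ε` and `E[F⁰] − E[F¹] = E[F⁰ ; B] − E[F¹ ; B]` (`F⁰`, `F¹` the phase sums of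
   `Λ δ` and of `shiftData (Λ δ) w`): same-`ω` coupling, ordered-excursion merge event (bare passage
   sharing admits `±2π` slips, `Cruxes/EdgePrecompact/ShiftCouplingWindingOffsetCex.md`), boundary
   three-arm / marked-point two-arm sums; no phase (the sibling's `Sig.stub_shiftCouplingLocality`,
   rewritten for the pointwise-`+ᵥ` `shiftData`, `image_add_right_eq_vadd`). Its left side is written
   with the full expectations `∫ F⁰ − ∫ F¹` rather than with `cornerObs`, so that the kernel pins the
   `F` of (X1)/(X2) to the actual integrand of `cornerObs` (via `cornerObs_eq_integral_dartPhaseSum` in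
   the proof below); a mis-typed integrand could otherwise hide inside an assumed identity.
3. THE REDUCTION `shiftStability_of : (X1) → (X2) → ShiftStability` (registered sub-goal), fully proved:
   `ρ = r/2` with `cthickening r K ⊆ D`, `ε₁ = ε ρ^{1/3}/2`, `ε'` from (X1), `η` from (X2) at `ε'`;
   (X2) carries the difference onto `B`, (X1) bounds both restricted expectations — the second for the
   translated datum, admissible by `isZdAdmissible_shiftData` and containing the ball since
   `‖δ(−w)‖ = dist (δv, δ(v+w)) < min η ρ`.

Also proved: `isZdAdmissible_shiftData` (admissibility transport, from the transport lemmas of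
`Theorems/CardyComplexConeEdgePrecompactMedialExplorationShiftData.lean`; used), the bridge
`cornerObs_eq_integral_dartPhaseSum` (used) / `cornerObs_eq_bondDartObservable` to the tree's
`DartPhase.lean`, and its corollary `norm_cornerObs_le_one` (`‖cornerObs‖ ≤ 1`, for the line's (T) at
depth `R = 1`).
-/

namespace Summit.CriticalPhenomena.CardyFormulaZ2.Cruxes.EdgePrecompact.QkzStripBoundaryArm

open MeasureTheory Filter Set Metric
open scoped Topology BigOperators Pointwise
open Literature.Probability.LatticeModels Literature.Probability.Percolation
open Literature.Probability.RandomPlanarGeometry (DobrushinDomain)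
open Summit.CriticalPhenomena.CardyFormulaZ2.Theses.CardyComplexCone

noncomputable section

/-! ## The corner observable is the spin-`1/3` dart observable of the tree -/

/-- The crux integrand is the tree's spin-`1/3` dart phase sum: `cornerObs E δ v f` is the
`P_{1/2}`-expectation of `dartPhaseSum (medialExploration E ω) δ (1/3) (v, f)` (`DartPhase.lean`), i.e.
`cornerObs E δ v f = bondDartObservable E δ (1/3) (v, f)`; only the numeral form of the exponent
`-(i/3)·W = -i·(1/3)·W` differs. -/
theorem cornerObs_eq_integral_dartPhaseSum (E : DiscreteDobrushin) (δ : ℝ) (v f : Site 2) :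
    cornerObs E δ v f = ∫ ω, dartPhaseSum (medialExploration E ω) δ (1 / 3) (v, f)
      ∂(bondPercolation (zdGraph 2) half) := by
  unfold cornerObs
  refine congrArg _ (funext fun ω => ?_)
  rw [dartPhaseSum_third]
  -- buildfix 2026-08-20 (proof-only, regime-robust): `cornerObs` spells the fully-qualified
  -- `Literature.Probability.LatticeModels.winding`, which is `FermionicObservable`'s copy whenever that
  -- module is in the import closure (the tree's `dartPhaseSum` uses `Polyline.winding`); bridge the two
  -- copies pointwise (`MedialWindingBridge`; a syntactic identity once the Literature dedupe lands).
  exact Finset.sum_congr rfl fun k _ => by rw [Polyline.winding_eq_winding]; congr 1; ring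

/-- The same identity with the tree's name for the expectation. -/
theorem cornerObs_eq_bondDartObservable (E : DiscreteDobrushin) (δ : ℝ) (v f : Site 2) :
    cornerObs E δ v f = bondDartObservable E δ (1 / 3) (v, f) := by
  rw [cornerObs_eq_integral_dartPhaseSum, bondDartObservable_def]

/-- `‖cornerObs E δ v f‖ ≤ 1` for all data, meshes and corners (the expectation of at most one
unimodular passage term; the small-depth case `R = 1` of the line's (T)). -/
theorem norm_cornerObs_le_one (E : DiscreteDobrushin) (δ : ℝ) (v f : Site 2) :
    ‖cornerObs E δ v f‖ ≤ 1 := by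
  rw [cornerObs_eq_bondDartObservable]
  exact norm_bondDartObservable_le_one E δ (1 / 3) (v, f)

/-! ## Lattice translations of discrete Dobrushin data preserve admissibility -/

/-- **Admissibility transport.** Translating discrete Dobrushin data by a lattice vector preserves
`ℤ²`-admissibility (bounded domain, positive mesh, nonempty disjoint discrete arcs covering the
discrete boundary, exactly two `A`–`B` edges each bordering exactly one inner face): every
ingredient is transported by `x ↦ x + w` (transport lemmas of
`CardyComplexConeEdgePrecompactMedialExplorationShiftData.lean`). This is the first conjunct of the
sibling line's `Sig.stub_translationCovariance`; the reduction feeds the translated datum to (X1). -/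
theorem isZdAdmissible_shiftData (E : DiscreteDobrushin) (w : Site 2) (hE : E.IsZdAdmissible) :
    (shiftData E w).IsZdAdmissible where
  isBounded := by
    rw [shiftData_Ω]
    exact hE.isBounded.vadd _
  delta_pos := hE.delta_pos
  zdArcA_nonempty := by
    obtain ⟨x, hx⟩ := hE.zdArcA_nonempty
    exact ⟨x + w, (mem_zdArcA_shiftData_iff E w x).2 hx⟩
  zdArcB_nonempty := by
    obtain ⟨x, hx⟩ := hE.zdArcB_nonempty
    exact ⟨x + w, (mem_zdArcB_shiftData_iff E w x).2 hx⟩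
  disjoint := by
    rw [Set.disjoint_left]
    intro x₁ hxA hxB
    obtain ⟨x, rfl⟩ := exists_add_eq_site w x₁
    exact Set.disjoint_left.1 hE.disjoint ((mem_zdArcA_shiftData_iff E w x).1 hxA)
      ((mem_zdArcB_shiftData_iff E w x).1 hxB)
  zdBoundary_subset := by
    intro x₁ hx
    obtain ⟨x, rfl⟩ := exists_add_eq_site w x₁
    rcases hE.zdBoundary_subset ((mem_zdBoundary_shiftData_iff E w x).1 hx) with h | h
    · exact Or.inl ((mem_zdArcA_shiftData_iff E w x).2 h)
    · exact Or.inr ((mem_zdArcB_shiftData_iff E w x).2 h)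
  ncard_zdABEdges_eq_two := by
    have himage : (shiftData E w).zdABEdges = sym2Equiv (Site.shift w) '' E.zdABEdges := by
      ext e₁
      obtain ⟨e, rfl⟩ := (sym2Equiv (Site.shift w)).surjective e₁
      rw [shift_mem_zdABEdges_iff, (sym2Equiv (Site.shift w)).injective.mem_set_image]
    rw [himage, Set.ncard_image_of_injective _ (sym2Equiv (Site.shift w)).injective]
    exact hE.ncard_zdABEdges_eq_two
  zdABEdges_inner := by
    intro e₁ he₁
    obtain ⟨e, rfl⟩ := (sym2Equiv (Site.shift w)).surjective e₁
    rw [shift_mem_zdABEdges_iff] at he₁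
    obtain ⟨f₀, ⟨hf₀, hcor⟩, huniq⟩ := hE.zdABEdges_inner e he₁
    refine ⟨f₀ + w, ⟨(isInnerFace_shiftData_iff E w f₀).2 hf₀,
      (forall_mem_shift_iff w e (fun x => IsCorner x (f₀ + w))).2
        fun x hx => (isCorner_add_iff x f₀ w).2 (hcor x hx)⟩, ?_⟩
    rintro f₁ ⟨hf₁, hcor₁⟩
    obtain ⟨f, rfl⟩ := exists_add_eq_site w f₁
    rw [isInnerFace_shiftData_iff] at hf₁
    have hcor' := (forall_mem_shift_iff w e (fun x => IsCorner x (f + w))).1 hcor₁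
    rw [huniq f ⟨hf₁, fun x hx => (isCorner_add_iff x f w).1 (hcor' x hx)⟩]

/-! ## The reduction: shift stability from its two inputs -/

/-- **Shift stability from (X1) uniform integrability of the localised twisted amplitude and (X2)
shift-coupling locality** (registered sub-goal `shiftStability_of` of stmt-CriticalPhenomena-11387).

* (X1) — the CONDITIONAL inner envelope in its weakest (uniform-integrability) form: for every
  `ε₁ > 0` there is `ε' > 0` such that for every `ℤ²`-admissible datum `E`, every corner `(v,f)`, every
  radius `ρ ≥ E.δ` with `closedBall (δv) ρ ⊆ E.Ω` and every event `A` that is measurable with respect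
  to the configuration OFF the ball `B(δv, ρ)` and has `P_{1/2}(A) ≤ ε'`:
  `‖E[F_{v,f} ; A]‖ ≤ ε₁ · (E.δ/ρ)^{1/3}`, `F_{v,f} = dartPhaseSum (medialExploration E ·) E.δ (1/3) (v,f)`
  (the integrand of `cornerObs`, `cornerObs_eq_integral_dartPhaseSum`). This is the decoupling of a
  small exterior event from the inner twisted amplitude — the open core of `stub_shiftStability`
  (the unconditional `UniformInnerEnvelope` bounds only `A = univ`).
* (X2) — SHIFT-COUPLING LOCALITY (coupling + ordered-excursion topology + boundary arm sums; no
  phase): along a discretisation family of `D`, on a compact `K` with `cthickening (2ρ) K ⊆ D`, for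
  every `ε > 0` there is `η > 0` such that eventually in `δ`, for every corner `(v,f)` with `δv ∈ K`
  and every lattice vector `w` with `‖δw‖ < η`, the difference of the corner observables of `Λ δ` and
  of its translate `shiftData (Λ δ) w` at `(v,f)` is CARRIED by an event `B`, measurable off the ball
  `B(δv, ρ)`, of probability `≤ ε`: `E₀ − E₁ = E[F₀ ; B] − E[F₁ ; B]`.

Proof: take `ρ = r/2` with `cthickening r K ⊆ D`, `ε₁ = ε ρ^{1/3}/2`, `ε'` from (X1), `η` from (X2)
at `ε'`; for `δ < ρ` admissible and `‖δ(−w)‖ = dist (δv, δ(v+w)) < min η ρ`, (X2) carries the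
difference onto `B`, and (X1) bounds both restricted expectations by `ε₁ (δ/ρ)^{1/3}` — the second
one for the translated datum, which is admissible (`isZdAdmissible_shiftData`) and contains the ball
(`closedBall (δv) ρ − δ(−w) ⊆ cthickening (2ρ) K ⊆ D`). `UniformInnerEnvelope` is not used. -/
theorem shiftStability_of :
    (∀ ε₁ > (0:ℝ), ∃ ε' > (0:ℝ), ∀ (E : DiscreteDobrushin), E.IsZdAdmissible →
      ∀ v f : Site 2, IsCorner v f → ∀ ρ : ℝ, E.δ ≤ ρ → closedBall (meshPoint E.δ v) ρ ⊆ E.Ω →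
      ∀ A : Set (BondConfig (Site 2)),
        MeasurableSet[MeasurableSpace.comap
          (fun ω : BondConfig (Site 2) => ω \ {e | medialPoint E.δ e ∈ ball (meshPoint E.δ v) ρ})
          (inferInstance : MeasurableSpace (BondConfig (Site 2)))] A →
        (bondPercolation (zdGraph 2) half).real A ≤ ε' →
        ‖∫ ω in A, dartPhaseSum (medialExploration E ω) E.δ (1 / 3) (v, f)
          ∂(bondPercolation (zdGraph 2) half)‖ ≤ ε₁ * (E.δ / ρ) ^ ((1:ℝ) / 3)) →
    (∀ (D : DobrushinDomain) (Λ : ℝ → DiscreteDobrushin),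
      (∀ δ, (Λ δ).Ω = D.carrier) → (∀ δ, (Λ δ).δ = δ) →
      (∀ᶠ δ in nhdsWithin (0:ℝ) (Set.Ioi 0), (Λ δ).IsZdAdmissible) →
      ∀ K : Set ℂ, IsCompact K → K ⊆ D.carrier →
      ∀ ρ > (0:ℝ), cthickening (2 * ρ) K ⊆ D.carrier →
      ∀ ε > (0:ℝ), ∃ η > (0:ℝ), ∀ᶠ δ in nhdsWithin (0:ℝ) (Set.Ioi 0), ∀ v f w : Site 2,
        IsCorner v f → meshPoint δ v ∈ K → ‖meshPoint δ w‖ < η →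
        ∃ B : Set (BondConfig (Site 2)),
          MeasurableSet[MeasurableSpace.comap
            (fun ω : BondConfig (Site 2) => ω \ {e | medialPoint δ e ∈ ball (meshPoint δ v) ρ})
            (inferInstance : MeasurableSpace (BondConfig (Site 2)))] B ∧
          (bondPercolation (zdGraph 2) half).real B ≤ ε ∧
          (∫ ω, dartPhaseSum (medialExploration (Λ δ) ω) δ (1 / 3) (v, f)
              ∂(bondPercolation (zdGraph 2) half)) -
            (∫ ω, dartPhaseSum (medialExploration (shiftData (Λ δ) w) ω) δ (1 / 3) (v, f)
              ∂(bondPercolation (zdGraph 2) half)) =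
          (∫ ω in B, dartPhaseSum (medialExploration (Λ δ) ω) δ (1 / 3) (v, f)
              ∂(bondPercolation (zdGraph 2) half)) -
            (∫ ω in B, dartPhaseSum (medialExploration (shiftData (Λ δ) w) ω) δ (1 / 3) (v, f)
              ∂(bondPercolation (zdGraph 2) half))) →
    ShiftStability := by
  intro hUI hSCL D Λ hΩ hδ hadm K hK hKD ε hε
  -- a uniform inner radius for `K` (interiority of `K` is load-bearing)
  obtain ⟨r, hr, hrK⟩ := hK.exists_cthickening_subset_open D.isOpen hKD
  set ρ : ℝ := r / 2 with hρdef
  have hρ : 0 < ρ := by positivity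
  have h2ρ : 2 * ρ = r := by rw [hρdef]; ring
  have hρK : cthickening (2 * ρ) K ⊆ D.carrier := by rw [h2ρ]; exact hrK
  have hρK' : cthickening ρ K ⊆ D.carrier := (cthickening_mono (by linarith) K).trans hρK
  have hpos : ∀ᶠ δ in 𝓝[>] (0:ℝ), 0 < δ := eventually_mem_nhdsWithin
  have hlt : ∀ᶠ δ in 𝓝[>] (0:ℝ), δ < ρ := (eventually_lt_nhds hρ).filter_mono nhdsWithin_le_nhds
  have hρ3 : 0 < ρ ^ ((1:ℝ) / 3) := Real.rpow_pos_of_pos hρ _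
  have hballK : ∀ (δ : ℝ) (v : Site 2), meshPoint δ v ∈ K →
      closedBall (meshPoint δ v) ρ ⊆ D.carrier := fun δ v hvK x hx =>
    hρK' (mem_cthickening_of_dist_le x (meshPoint δ v) ρ K hvK (mem_closedBall.1 hx))
  -- constants
  set ε₁ : ℝ := ε * ρ ^ ((1:ℝ) / 3) / 2 with hε₁def
  have hε₁ : 0 < ε₁ := by positivity
  obtain ⟨ε', hε', hC⟩ := hUI ε₁ hε₁
  obtain ⟨η, hη, hev⟩ := hSCL D Λ hΩ hδ hadm K hK hKD ρ hρ hρK ε' hε'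
  refine ⟨min η ρ, lt_min hη hρ, ?_⟩
  filter_upwards [hev, hadm, hpos, hlt] with δ hevδ hadmδ hδpos hδρ
  intro v f w hvf hvK _hvwK hdist
  have hΛδ : (Λ δ).δ = δ := hδ δ
  -- the data are shifted by `u := -w`, `‖δu‖ = dist (δv) (δ(v+w)) < min η ρ`
  have hnormu : ‖meshPoint δ (-w)‖ < min η ρ := by
    have : meshPoint δ (-w) = meshPoint δ v - meshPoint δ (v + w) := by
      rw [meshPoint_neg, meshPoint_add_shift]; ring
    rw [this, ← dist_eq_norm]; exact hdist
  have hηu : ‖meshPoint δ (-w)‖ < η := lt_of_lt_of_le hnormu (min_le_left _ _)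
  have hρu : ‖meshPoint δ (-w)‖ < ρ := lt_of_lt_of_le hnormu (min_le_right _ _)
  -- (X2): the difference is carried by an exterior-measurable event `B` of probability `≤ ε'`
  obtain ⟨B, hBmeas, hBprob, hBdiff⟩ := hevδ v f (-w) hvf hvK hηu
  -- (X1) on `B` for the datum `Λ δ` …
  have key₀ := hC (Λ δ) hadmδ v f hvf ρ (by rw [hΛδ]; exact hδρ.le)
    (by rw [hΛδ, hΩ]; exact hballK δ v hvK) B (by rw [hΛδ]; exact hBmeas) hBprob
  rw [hΛδ] at key₀
  -- … and for the translated datum (admissible by transport; its ball lies in `D + δ(-w)`)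
  have hδT : (shiftData (Λ δ) (-w)).δ = δ := hΛδ
  have hball₁ : closedBall (meshPoint δ v) ρ ⊆ (shiftData (Λ δ) (-w)).Ω := by
    intro x hx
    rw [shiftData_Ω, hΩ, hΛδ]
    refine Set.mem_vadd_set.2 ⟨x - meshPoint δ (-w), ?_, by simp⟩
    apply hρK
    refine mem_cthickening_of_dist_le (x - meshPoint δ (-w)) (meshPoint δ v) (2 * ρ) K hvK ?_
    calc dist (x - meshPoint δ (-w)) (meshPoint δ v)
        ≤ dist (x - meshPoint δ (-w)) x + dist x (meshPoint δ v) := dist_triangle _ _ _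
      _ = ‖meshPoint δ (-w)‖ + dist x (meshPoint δ v) := by
          rw [dist_eq_norm]; congr 1; simp
      _ ≤ ρ + ρ := add_le_add hρu.le (mem_closedBall.1 hx)
      _ = 2 * ρ := by ring
  have key₁ := hC (shiftData (Λ δ) (-w)) (isZdAdmissible_shiftData _ _ hadmδ) v f hvf ρ
    (by rw [hδT]; exact hδρ.le) (by rw [hδT]; exact hball₁) B (by rw [hδT]; exact hBmeas) hBprob
  rw [hδT] at key₁
  -- assemble: the corner observables are the full expectations of the two phase sums
  rw [cornerObs_eq_integral_dartPhaseSum, cornerObs_eq_integral_dartPhaseSum, hBdiff]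
  have hsplit : (δ / ρ) ^ ((1:ℝ) / 3) = δ ^ ((1:ℝ) / 3) / ρ ^ ((1:ℝ) / 3) :=
    Real.div_rpow hδpos.le hρ.le _
  calc ‖(∫ ω in B, dartPhaseSum (medialExploration (Λ δ) ω) δ (1 / 3) (v, f)
            ∂(bondPercolation (zdGraph 2) half)) -
          (∫ ω in B, dartPhaseSum (medialExploration (shiftData (Λ δ) (-w)) ω) δ (1 / 3) (v, f)
            ∂(bondPercolation (zdGraph 2) half))‖
      ≤ ‖∫ ω in B, dartPhaseSum (medialExploration (Λ δ) ω) δ (1 / 3) (v, f)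
            ∂(bondPercolation (zdGraph 2) half)‖ +
          ‖∫ ω in B, dartPhaseSum (medialExploration (shiftData (Λ δ) (-w)) ω) δ (1 / 3) (v, f)
            ∂(bondPercolation (zdGraph 2) half)‖ := norm_sub_le _ _
    _ ≤ ε₁ * (δ / ρ) ^ ((1:ℝ) / 3) + ε₁ * (δ / ρ) ^ ((1:ℝ) / 3) := add_le_add key₀ key₁
    _ = ε * δ ^ ((1:ℝ) / 3) := by
        rw [hsplit, hε₁def]
        field_simp
        ring

end

end Summit.CriticalPhenomena.CardyFormulaZ2.Cruxes.EdgePrecompact.QkzStripBoundaryArm
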